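import Summits.QuantumFields.BalabanUV.T4Continuum.Support.RegionBoxCollarFold

/-!
# `BalabanUV.T4Continuum.Support.RegionBoxCollarCutoff` — NE2 (node U1a) formalisation swarm, SUPPLIER item «Δ1-VEC-W1-HOLED» v3 under the
# owner's sub-row `T4-U1a.S-NE2-D1-DIRICHLET°` (vector layer W1): THE CUTOFF AND THE LIFT FOR THE COLLAR OF A BOX OF BLOCKS, bond by bond
# «not in print; our construction» (unit b2b-balaban-t4-ne2-formalise-leaf-09, gen 9, v1)

HONEST FRAMING (T4-DAG p. 1).  [folklore] the generalisation of `RegionCollarCutoff` (one block) to a box `K = Π_ν [lo_ν, lo_ν + len_ν)`: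
profile `ψ_ν(0,t) = t/n`, `ψ_ν(k,·) = 1` for `1 ≤ k ≤ len_ν`, `ψ_ν(len_ν+1,t) = (n−1−t)/n`, `0` beyond; `χ = Π_ν ψ_ν(koff_ν, j_ν)` (`= 1` on `K`,
`1/n`-Lipschitz along bonds, `0` off the collar and on its outer layer); `lift g = χ·(g ∘ F)` (`= g` on `K`); the bond-by-bond inequality
`n²‖lift(x+e_ρ) − lift x‖² ≤ 2·Dterm + 2‖g(F x)‖²` with `Dterm` the image-bond term (in-block steps AND the crossings between adjacent blocks
of `K`), and `lift(x+e_ρ) − lift x = 0` off the collar.  Nothing printed is a hypothesis; NE2 (U1a) NOT proved; spine PROVED 0/9 unchanged; NOT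
[B9] (3.23)–(3.27) as printed; NOT infinite volume, NOT the mass gap, NOT Clay.  HONEST DEPENDENCY (verbatim): «continuum YM on T⁴ ⇐ BetaPertH
∧ nine spine estimates (0/9 proved); BetaPertH ⇐ (D1) ∧ (D4) ∧ CAP+tail; G-an2-4 gates asym, D1 and NE2/3/4.»

ABSOLUTE RULE (cell, verbatim): «No internally-minted statement may enter as a cited fact. Every hypothesis is either kernel-proved in
this package or a verbatim quotation of a PUBLISHED theorem with page reference. The manuscript(s) under audit are NOT citable for
their own disputed steps — they are the thing under adjudication; programme-internal (2001/route/tribunal) claims are never citable.»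
[folklore] throughout; data defs `psiB`, `chiB`, `PfacB`, `liftB`, `DtermB`; no `def … : Prop`.  NOT CLAIMED: anything about the operator yet.
-/

noncomputable section

open scoped BigOperators ComplexConjugate Matrix
open Finset

namespace Summit.QuantumFields.BalabanUV.T4Continuum.RegionBoxCollarCutoff

open Literature.MathematicalPhysics.QuantumFieldTheory.Balaban1983to89.B5Prop11Plancherel (Tor fine unitVec)
open Literature.MathematicalPhysics.QuantumFieldTheory.Balaban1983to89.B5Prop11Lower (nsq nsq_nonneg)
open Literature.MathematicalPhysics.QuantumFieldTheory.Balaban1983to89.B5Block118 (bpt)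
open Literature.MathematicalPhysics.QuantumFieldTheory.Balaban1983to89.B5Blocks16 (blockOf blockOf_bpt)
open Summit.QuantumFields.BalabanUV.T4Continuum
open Summit.QuantumFields.BalabanUV.T4Continuum.ScalarBlockTrialFunction (digits digits_bpt)
open Summit.QuantumFields.BalabanUV.T4Continuum.RegionCollarFold (koff digits_add_unitVec_of_eq digits_add_unitVec_of_lt
  koff_add_unitVec_of_ne koff_add_unitVec_of_lt koff_add_unitVec_of_eq)
open Summit.QuantumFields.BalabanUV.T4Continuum.RegionCollarCutoff (prod_rule_sq)
open Summit.QuantumFields.BalabanUV.T4Continuum.RegionBoxCollarFold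

variable {d : ℕ} (n : ℕ) [NeZero n] (M : Fin d → ℕ) [hM : ∀ μ, NeZero (M μ)] (lo : Tor M) (len : Fin d → ℕ)

/-! ## §1 The profile and the cutoff -/

/-- the one-dimensional profile across the `len + 2` collar blocks of a direction. [folklore] -/
def psiB (l k t : ℕ) : ℝ :=
  if k = 0 then (t : ℝ) / n else if k ≤ l then 1 else if k = l + 1 then ((n : ℝ) - 1 - t) / n else 0

/-- **THE BOX COLLAR CUTOFF** `χ(x) = Π_μ ψ_μ(koff_μ x, digit_μ x)`. [folklore] -/
def chiB (x : Tor (fine n M)) : ℝ := ∏ μ, psiB n (len μ) (koff n M lo x μ) (digits n M x μ : ℕ)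

/-- the product of the profile factors off one direction. [folklore] -/
def PfacB (x : Tor (fine n M)) (ρ : Fin d) : ℝ := ∏ μ ∈ univ.erase ρ, psiB n (len μ) (koff n M lo x μ) (digits n M x μ : ℕ)

omit [NeZero n] in
/-- `0 ≤ ψ` on digits `t < n`. [folklore] -/
theorem psiB_nonneg (l : ℕ) {k t : ℕ} (ht : t < n) : 0 ≤ psiB n l k t := by
  have hn : (0 : ℝ) < n := by exact_mod_cast (Nat.zero_lt_of_lt ht)
  have ht' : (t : ℝ) + 1 ≤ n := by exact_mod_cast ht
  unfold psiB
  split_ifs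
  · positivity
  · norm_num
  · apply div_nonneg _ hn.le; linarith
  · exact le_rfl

omit [NeZero n] in
/-- `ψ ≤ 1`. [folklore] -/
theorem psiB_le_one (l : ℕ) {k t : ℕ} (ht : t < n) : psiB n l k t ≤ 1 := by
  have hn : (0 : ℝ) < n := by exact_mod_cast (Nat.zero_lt_of_lt ht)
  have ht' : (t : ℝ) + 1 ≤ n := by exact_mod_cast ht
  unfold psiB
  split_ifs
  · rw [div_le_one hn]; linarith
  · exact le_rfl
  · rw [div_le_one hn]; linarith [Nat.cast_nonneg (α := ℝ) t]
  · norm_num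

omit [NeZero n] in
/-- `ψ(k, ·) = 1` inside. [folklore] -/
theorem psiB_inside {l k : ℕ} (h1 : 1 ≤ k) (h2 : k ≤ l) (t : ℕ) : psiB n l k t = 1 := by
  unfold psiB; rw [if_neg (by omega), if_pos h2]

omit [NeZero n] in
/-- `ψ(k, ·) = 0` beyond the collar (`l + 2 ≤ k`). [folklore] -/
theorem psiB_of_ge {l k : ℕ} (hk : l + 2 ≤ k) (t : ℕ) : psiB n l k t = 0 := by
  unfold psiB; rw [if_neg (by omega), if_neg (by omega), if_neg (by omega)]

omit [NeZero n] in
/-- `ψ(0, 0) = 0`. [folklore] -/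
theorem psiB_zero_zero (l : ℕ) : psiB n l 0 0 = 0 := by simp [psiB]

omit [NeZero n] in
/-- `ψ(l+1, n−1) = 0`. [folklore] -/
theorem psiB_top_last (l : ℕ) {t : ℕ} (ht : t + 1 = n) : psiB n l (l + 1) t = 0 := by
  have : ((n : ℝ) - 1 - t) = 0 := by
    have h : (t : ℝ) + 1 = n := by exact_mod_cast ht
    linarith
  unfold psiB
  rw [if_neg (by omega), if_neg (by omega), if_pos rfl, this, zero_div]

omit [NeZero n] in
/-- the profile is `1/n`-Lipschitz inside a block. [folklore] -/
theorem psiB_step_le (l k : ℕ) {t : ℕ} (ht : t + 1 < n) : |psiB n l k (t + 1) - psiB n l k t| ≤ 1 / n := by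
  have hn : (0 : ℝ) < n := by exact_mod_cast (Nat.zero_lt_of_lt ht)
  unfold psiB
  split_ifs
  · rw [Nat.cast_succ, add_div, add_sub_cancel_left, abs_of_nonneg (by positivity)]
  · simp
  · rw [Nat.cast_succ, show ((n : ℝ) - 1 - (t + 1)) / n - ((n : ℝ) - 1 - t) / n = -(1 / n) by ring, abs_neg,
      abs_of_nonneg (by positivity)]
  · simp

omit [NeZero n] in
/-- … and across every interface `k → k + 1` with `k ≤ l` (from digit `n−1` to digit `0`). [folklore] -/
theorem psiB_cross_le {l k t : ℕ} (hk : k ≤ l) (ht : t + 1 = n) : |psiB n l (k + 1) 0 - psiB n l k t| ≤ 1 / n := by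
  have hn : (0 : ℝ) < n := by
    have : 0 < n := by omega
    exact_mod_cast this
  have ht' : (t : ℝ) = n - 1 := by
    have h : (t : ℝ) + 1 = n := by exact_mod_cast ht
    linarith
  by_cases h0 : k = 0
  · subst h0
    by_cases hl : 1 ≤ l
    · rw [psiB_inside n le_rfl hl]
      simp only [psiB, if_true, ht']
      rw [show (1 : ℝ) - (n - 1) / n = 1 / n by field_simp; ring, abs_of_nonneg (by positivity)]
    · have hl0 : l = 0 := by omega
      subst hl0
      simp only [psiB, zero_add, one_ne_zero, if_false, if_true, ht', Nat.cast_zero, sub_zero,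
        show ¬ (1 ≤ 0) from by omega]
      rw [show ((n : ℝ) - 1) / n - (n - 1) / n = 0 by ring, abs_zero]; positivity
  · by_cases hkl : k + 1 ≤ l
    · rw [psiB_inside n (by omega) hkl, psiB_inside n (by omega) hk, sub_self, abs_zero]; positivity
    · have hkeq : k = l := by omega
      subst hkeq
      rw [psiB_inside n (by omega) le_rfl]
      unfold psiB
      rw [if_neg (by omega), if_neg (by omega), if_pos rfl, Nat.cast_zero, sub_zero,
        show ((n : ℝ) - 1) / n - 1 = -(1 / n) by field_simp; ring, abs_neg, abs_of_nonneg (by positivity)]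

/-- `χ = ψ_ρ · P_ρ`. [folklore] -/
theorem chiB_eq_mul (x : Tor (fine n M)) (ρ : Fin d) :
    chiB n M lo len x = psiB n (len ρ) (koff n M lo x ρ) (digits n M x ρ : ℕ) * PfacB n M lo len x ρ := by
  rw [chiB, PfacB, ← Finset.mul_prod_erase univ _ (mem_univ ρ)]

/-- `0 ≤ P_ρ`. [folklore] -/
theorem PfacB_nonneg (x : Tor (fine n M)) (ρ : Fin d) : 0 ≤ PfacB n M lo len x ρ :=
  prod_nonneg fun μ _ => psiB_nonneg n _ (digits n M x μ).isLt

/-- `P_ρ ≤ 1`. [folklore] -/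
theorem PfacB_le_one (x : Tor (fine n M)) (ρ : Fin d) : PfacB n M lo len x ρ ≤ 1 :=
  prod_le_one (fun μ _ => psiB_nonneg n _ (digits n M x μ).isLt) fun μ _ => psiB_le_one n _ (digits n M x μ).isLt

/-- `0 ≤ χ`. [folklore] -/
theorem chiB_nonneg (x : Tor (fine n M)) : 0 ≤ chiB n M lo len x := prod_nonneg fun μ _ => psiB_nonneg n _ (digits n M x μ).isLt

/-- `χ ≤ 1`. [folklore] -/
theorem chiB_le_one (x : Tor (fine n M)) : chiB n M lo len x ≤ 1 :=
  prod_le_one (fun μ _ => psiB_nonneg n _ (digits n M x μ).isLt) fun μ _ => psiB_le_one n _ (digits n M x μ).isLt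

/-- **`χ = 1` ON THE BOX**. [folklore] -/
theorem chiB_of_inside {x : Tor (fine n M)} (hx : ∀ ν, 1 ≤ koff n M lo x ν ∧ koff n M lo x ν ≤ len ν) : chiB n M lo len x = 1 :=
  prod_eq_one fun μ _ => psiB_inside n (hx μ).1 (hx μ).2 _

/-- `χ = 0` as soon as one factor vanishes. [folklore] -/
theorem chiB_eq_zero_of (x : Tor (fine n M)) {ν : Fin d} (h : psiB n (len ν) (koff n M lo x ν) (digits n M x ν : ℕ) = 0) :
    chiB n M lo len x = 0 :=
  prod_eq_zero (mem_univ ν) h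

/-- **`χ = 0` OFF THE COLLAR**. [folklore] -/
theorem chiB_eq_zero_of_not_mem {x : Tor (fine n M)} (hx : x ∉ collarB n M lo len) : chiB n M lo len x = 0 := by
  simp only [mem_collarB, not_forall, not_lt] at hx
  obtain ⟨ν, hν⟩ := hx
  exact chiB_eq_zero_of n M lo len x (psiB_of_ge n hν _)

/-- the `P_ρ`-factor does not change under a `ρ`-step inside a block. [folklore] -/
theorem PfacB_add_unitVec_of_lt (x : Tor (fine n M)) (ρ : Fin d) (h : (digits n M x ρ : ℕ) + 1 < n) :
    PfacB n M lo len (x + unitVec (fine n M) ρ) ρ = PfacB n M lo len x ρ := by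
  refine prod_congr rfl fun μ hμ => ?_
  have hne : μ ≠ ρ := ne_of_mem_erase hμ
  rw [koff_add_unitVec_of_lt n M lo x ρ h, digits_add_unitVec_of_lt n M x ρ h, Function.update_of_ne hne]

/-- … nor under a `ρ`-step across a face. [folklore] -/
theorem PfacB_add_unitVec_of_eq (x : Tor (fine n M)) (ρ : Fin d) (h : (digits n M x ρ : ℕ) + 1 = n) :
    PfacB n M lo len (x + unitVec (fine n M) ρ) ρ = PfacB n M lo len x ρ := by
  refine prod_congr rfl fun μ hμ => ?_
  have hne : μ ≠ ρ := ne_of_mem_erase hμ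
  rw [koff_add_unitVec_of_ne n M lo x hne, digits_add_unitVec_of_eq n M x ρ h, Function.update_of_ne hne]

/-! ## §2 The lift and its gradient, bond by bond -/

/-- **THE LIFT** of a scalar from the box to its collar: `lift g = χ · (g ∘ F)`. [folklore] -/
def liftB (g : Tor (fine n M) → ℂ) : Tor (fine n M) → ℂ := fun x => (chiB n M lo len x : ℂ) * g (foldB n M lo len x)

/-- **`lift g = g` ON THE BOX**. [folklore] -/
theorem liftB_of_inside (g : Tor (fine n M) → ℂ) {x : Tor (fine n M)} (hx : ∀ ν, 1 ≤ koff n M lo x ν ∧ koff n M lo x ν ≤ len ν) :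
    liftB n M lo len g x = g x := by
  rw [liftB, chiB_of_inside n M lo len hx, foldB_of_inside n M lo len hx, Complex.ofReal_one, one_mul]

/-- `lift g = 0` off the collar. [folklore] -/
theorem liftB_of_not_mem (g : Tor (fine n M) → ℂ) {x : Tor (fine n M)} (hx : x ∉ collarB n M lo len) : liftB n M lo len g x = 0 := by
  rw [liftB, chiB_eq_zero_of_not_mem n M lo len hx, Complex.ofReal_zero, zero_mul]

/-- the image-bond term at a collar site: present on in-block steps and on the crossings between adjacent blocks of the box. [folklore] -/
def DtermB (g : Tor (fine n M) → ℂ) (k : Fin d → ℕ) (j : Fin d → Fin n) (ρ : Fin d) : ℝ :=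
  if (j ρ : ℕ) + 1 < n ∨ (1 ≤ k ρ ∧ k ρ + 1 ≤ len ρ) then
    (n : ℝ) ^ 2 * ‖g (foldB n M lo len (csiteB n M lo k j + unitVec (fine n M) ρ)) - g (foldB n M lo len (csiteB n M lo k j))‖ ^ 2
  else 0

/-- `0 ≤ Dterm`. [folklore] -/
theorem DtermB_nonneg (g : Tor (fine n M) → ℂ) (k : Fin d → ℕ) (j : Fin d → Fin n) (ρ : Fin d) : 0 ≤ DtermB n M lo len g k j ρ := by
  unfold DtermB; split_ifs <;> positivity

/-- **THE GRADIENT OF THE LIFT AT A COLLAR SITE, BOND BY BOND** (`k ∈ KOff`, `1 ≤ len_ν`, `len_ν + 2 ≤ M_ν`):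
`n²‖lift(x + e_ρ) − lift(x)‖² ≤ 2·Dterm + 2·‖g(F x)‖²`. [folklore] -/
theorem liftB_step_sq_le (hlen : ∀ ν, 1 ≤ len ν) (hM2 : ∀ μ, len μ + 2 ≤ M μ) (g : Tor (fine n M) → ℂ) {k : Fin d → ℕ}
    (hk : k ∈ KOff len) (j : Fin d → Fin n) (ρ : Fin d) :
    (n : ℝ) ^ 2 * ‖liftB n M lo len g (csiteB n M lo k j + unitVec (fine n M) ρ) - liftB n M lo len g (csiteB n M lo k j)‖ ^ 2
      ≤ 2 * DtermB n M lo len g k j ρ + 2 * ‖g (foldB n M lo len (csiteB n M lo k j))‖ ^ 2 := by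
  have hMge2 : ∀ μ, 2 ≤ M μ := fun μ => by have := hM2 μ; omega
  have hn : 0 < n := Nat.pos_of_ne_zero (NeZero.ne n)
  set x := csiteB n M lo k j with hx
  have hkM := lt_M_of_mem_KOff M len hM2 hk
  have hkoff : koff n M lo x = k := koffB_csiteB n M lo k hkM j
  have hkoffν : ∀ ν, koff n M lo x ν = k ν := fun ν => congrFun hkoff ν
  have hdig : digits n M x = j := digits_csiteB n M lo k j
  have hklt : k ρ < len ρ + 2 := (mem_KOff len).1 hk ρ
  by_cases hlt : (j ρ : ℕ) + 1 < n
  · -- interior step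
    rw [DtermB, if_pos (Or.inl hlt)]
    have hlt' : (digits n M x ρ : ℕ) + 1 < n := by rw [hdig]; exact hlt
    have hd' : (digits n M (x + unitVec (fine n M) ρ) ρ : ℕ) = (j ρ : ℕ) + 1 := by
      have h := congrArg (fun f : Fin d → Fin n => (f ρ : ℕ)) (digits_add_unitVec_of_lt n M x ρ hlt')
      simp only [Function.update_self] at h
      rw [h, hdig]
    have hchi' : chiB n M lo len (x + unitVec (fine n M) ρ) = psiB n (len ρ) (k ρ) ((j ρ : ℕ) + 1) * PfacB n M lo len x ρ := by
      rw [chiB_eq_mul n M lo len _ ρ, koff_add_unitVec_of_lt n M lo x ρ hlt', hd', PfacB_add_unitVec_of_lt n M lo len x ρ hlt', hkoffν]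
    have hchi : chiB n M lo len x = psiB n (len ρ) (k ρ) (j ρ : ℕ) * PfacB n M lo len x ρ := by
      rw [chiB_eq_mul n M lo len x ρ, hkoffν, hdig]
    refine prod_rule_sq n hn ?_ ?_
    · rw [abs_of_nonneg (chiB_nonneg n M lo len _)]; exact chiB_le_one n M lo len _
    · rw [hchi', hchi, ← sub_mul, abs_mul, abs_of_nonneg (PfacB_nonneg n M lo len x ρ)]
      calc |psiB n (len ρ) (k ρ) ((j ρ : ℕ) + 1) - psiB n (len ρ) (k ρ) (j ρ : ℕ)| * PfacB n M lo len x ρ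
          ≤ 1 / n * 1 :=
            mul_le_mul (psiB_step_le n _ _ hlt) (PfacB_le_one n M lo len x ρ) (PfacB_nonneg n M lo len x ρ) (by positivity)
        _ = 1 / n := mul_one _
  · -- crossing a face
    have heq : (j ρ : ℕ) + 1 = n := by have := (j ρ).isLt; omega
    have heq' : (digits n M x ρ : ℕ) + 1 = n := by rw [hdig]; exact heq
    have hd0 : (digits n M (x + unitVec (fine n M) ρ) ρ : ℕ) = 0 := by
      rw [digits_add_unitVec_of_eq n M x ρ heq', Function.update_self, Fin.val_zero]
    by_cases htop : k ρ = len ρ + 1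
    · -- leaving the collar: both ends vanish
      rw [DtermB, if_neg (by omega), mul_zero, zero_add]
      have h0 : chiB n M lo len x = 0 :=
        chiB_eq_zero_of n M lo len x (ν := ρ) (by rw [hkoffν, hdig, htop]; exact psiB_top_last n _ heq)
      have h0' : chiB n M lo len (x + unitVec (fine n M) ρ) = 0 := by
        rcases koff_add_unitVec_of_eq n M lo hMge2 x ρ heq' with h3 | ⟨h00, -⟩
        · exact chiB_eq_zero_of n M lo len _ (ν := ρ) (psiB_of_ge n (by rw [h3, hkoffν, htop]) _)
        · refine chiB_eq_zero_of n M lo len _ (ν := ρ) ?_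
          rw [h00, hd0, psiB_zero_zero]
      rw [liftB, liftB, h0, h0', Complex.ofReal_zero, zero_mul, zero_mul, sub_zero, norm_zero]
      have : (0 : ℝ) ≤ 2 * ‖g (foldB n M lo len x)‖ ^ 2 := by positivity
      simp [this]
    · -- a crossing inside the collar: `k ρ ≤ len ρ`
      have hkle : k ρ ≤ len ρ := by omega
      have hko : koff n M lo (x + unitVec (fine n M) ρ) ρ = k ρ + 1 := by
        rcases koff_add_unitVec_of_eq n M lo hMge2 x ρ heq' with h3 | ⟨-, hwrap⟩
        · rw [h3, hkoffν]
        · exfalso; rw [hkoffν] at hwrap; have := hM2 ρ; omega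
      have hchi' : chiB n M lo len (x + unitVec (fine n M) ρ) = psiB n (len ρ) (k ρ + 1) 0 * PfacB n M lo len x ρ := by
        rw [chiB_eq_mul n M lo len _ ρ, hko, hd0, PfacB_add_unitVec_of_eq n M lo len x ρ heq']
      have hchi : chiB n M lo len x = psiB n (len ρ) (k ρ) (j ρ : ℕ) * PfacB n M lo len x ρ := by
        rw [chiB_eq_mul n M lo len x ρ, hkoffν, hdig]
      have hcc : |chiB n M lo len (x + unitVec (fine n M) ρ) - chiB n M lo len x| ≤ 1 / n := by
        rw [hchi', hchi, ← sub_mul, abs_mul, abs_of_nonneg (PfacB_nonneg n M lo len x ρ)]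
        calc |psiB n (len ρ) (k ρ + 1) 0 - psiB n (len ρ) (k ρ) (j ρ : ℕ)| * PfacB n M lo len x ρ
            ≤ 1 / n * 1 :=
              mul_le_mul (psiB_cross_le n hkle heq) (PfacB_le_one n M lo len x ρ) (PfacB_nonneg n M lo len x ρ) (by positivity)
          _ = 1 / n := mul_one _
      have hc1 : |chiB n M lo len (x + unitVec (fine n M) ρ)| ≤ 1 := by
        rw [abs_of_nonneg (chiB_nonneg n M lo len _)]; exact chiB_le_one n M lo len _
      have h := prod_rule_sq n hn (a := g (foldB n M lo len x)) (a' := g (foldB n M lo len (x + unitVec (fine n M) ρ)))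
        (c := chiB n M lo len x) (c' := chiB n M lo len (x + unitVec (fine n M) ρ)) hc1 hcc
      by_cases hin : 1 ≤ k ρ ∧ k ρ + 1 ≤ len ρ
      · -- crossing between two adjacent blocks of the box: the image bond is an inter-block bond (present in `Dterm`)
        rw [DtermB, if_pos (Or.inr hin), liftB, liftB]
        exact h
      · -- entering (`k ρ = 0`) or exiting (`k ρ = len ρ`): the fold does not move
        rw [DtermB, if_neg (by omega), mul_zero, zero_add]
        have hF : foldB n M lo len (x + unitVec (fine n M) ρ) = foldB n M lo len x := by
          rcases Nat.eq_zero_or_pos (k ρ) with h0 | hpos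
          · exact foldB_cross_enter n M lo len hM2 hlen hk j ρ heq h0
          · exact foldB_cross_exit n M lo len hM2 hlen hk j ρ heq (by omega)
        rw [hF, sub_self, norm_zero] at h
        rw [liftB, liftB, hF]
        nlinarith [h]

/-- **OFF THE COLLAR THE LIFT HAS NO GRADIENT**. [folklore] -/
theorem liftB_step_of_not_mem (hM2 : ∀ μ, len μ + 2 ≤ M μ) (g : Tor (fine n M) → ℂ) {x : Tor (fine n M)}
    (hx : x ∉ collarB n M lo len) (ρ : Fin d) : liftB n M lo len g (x + unitVec (fine n M) ρ) - liftB n M lo len g x = 0 := by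
  have hMge2 : ∀ μ, 2 ≤ M μ := fun μ => by have := hM2 μ; omega
  rw [liftB_of_not_mem n M lo len g hx, sub_zero]
  simp only [mem_collarB, not_forall, not_lt] at hx
  obtain ⟨ν, hν⟩ := hx
  rw [liftB]
  suffices h : chiB n M lo len (x + unitVec (fine n M) ρ) = 0 by rw [h, Complex.ofReal_zero, zero_mul]
  by_cases hνρ : ν = ρ
  · subst hνρ
    by_cases hlt : (digits n M x ν : ℕ) + 1 < n
    · exact chiB_eq_zero_of n M lo len _ (ν := ν) (psiB_of_ge n (by rw [koff_add_unitVec_of_lt n M lo x ν hlt]; exact hν) _)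
    · have heq : (digits n M x ν : ℕ) + 1 = n := by have := (digits n M x ν).isLt; omega
      rcases koff_add_unitVec_of_eq n M lo hMge2 x ν heq with h3 | ⟨h00, -⟩
      · exact chiB_eq_zero_of n M lo len _ (ν := ν) (psiB_of_ge n (by rw [h3]; omega) _)
      · refine chiB_eq_zero_of n M lo len _ (ν := ν) ?_
        rw [h00, digits_add_unitVec_of_eq n M x ν heq, Function.update_self, Fin.val_zero, psiB_zero_zero]
  · exact chiB_eq_zero_of n M lo len _ (ν := ν) (psiB_of_ge n (by rw [koff_add_unitVec_of_ne n M lo x hνρ]; exact hν) _)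

end Summit.QuantumFields.BalabanUV.T4Continuum.RegionBoxCollarCutoff

end
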